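import Literature.MathematicalPhysics.QuantumLattice.ReducedBCSTorus
import Mathlib.Tactic.NoncommRing
import Mathlib.Tactic.Module
import HarnessLib

/-!
# The BdG pair block: `ξ(n₁ + n₂) - a(b + b†) ≥ ξ - √(ξ² + a²)` as a sum of CAR squares

Family `hubbard` / trunk T-QLATTICE. For two fermion modes `c₁, c₂` satisfying the canonical
anticommutation relations (`c_i² = 0`, `{c₁, c₂} = 0`, `{c_i, c_i†} = 1`, `{c₁, c₂†} = 0`), the
"BdG pair block" `A = ξ(n₁ + n₂) - a(b + b†)` (`n_i = c_i†c_i`, `b = c₂c₁`; `ξ` a level energy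
measured from the chemical potential, `a` a real pair amplitude) has spectrum `ξ ± √(ξ² + a²)` on the
pair states `|0⟩, b†|0⟩` and `ξ` (twice) on the singly occupied states. We prove the operator
inequality `A ≥ (ξ - √(ξ² + a²))·1` in the strongest elementary form, an explicit SUM OF SQUARES in
the CAR algebra (`bdg_pairBlock_eq_sum_sq`):
`A - λ = Y†Y + (γQ₁)†(γQ₁) + (γQ₂)†(γQ₂)`, `Y = α(1-n₁)(1-n₂) + βb`, `Q₁ = n₁(1-n₂)`, `Q₂ = n₂(1-n₁)`,
whenever `α² = -λ`, `β² = 2ξ - λ`, `αβ = -a`, `γ² = ξ - λ` (solvable exactly for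
`λ = ξ - √(ξ² + a²)`), hence `Matrix.PosSemidef (A - λ·1)` (`bdg_pairBlock_posSemidef`); and we
specialise to the time-reversed pair modes `(k↑, -k↓)` of the fermionic torus
(`pairMode_block_posSemidef`: `ξ(n_{k↑} + n_{-k↓}) - a(b_k + b_k†) ≥ ξ - √(ξ² + a²)`,
`b_k = pairMode k` of `ReducedBCSTorus.lean`).

This is the finite-dimensional core of BCS/Bogoliubov LOWER bounds for quadratic-plus-pairing
Hamiltonians (summing the blocks over `k` bounds a sourced free Fermi gas from below by
`Σ_k (ξ_k - √(ξ_k² + a_k²))`); requested by the standing disprover of crux `WcbcsBcsConstruction`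
(route `HubbardSuperconductivity/WeakCouplingBCS`) for the free-gas anchor `dWaveOrderParameter 0 μ = 0`
and usable by the routes `BcsKacWindow`, `DeformationLadder`, `TorusCooperLog`.

Sources: P. G. de Gennes, *Superconductivity of Metals and Alloys* (1966), Ch. 5 (the BdG
equations); J. von Delft, D. C. Ralph, Phys. Rep. 345 (2001) 61, §4.2 (pair modes, blocking of singly
occupied levels); V. Bach, E. H. Lieb, J. P. Solovej, J. Stat. Phys. 76 (1994) 3, §2 (quasi-free
bounds). All statements are folklore algebra; no named facts. Mathlib/tree search: `lean search
"BdG|Bogoliubov|pairBlock|quasiparticle"` — only `BdGBondHamiltonian(Torus).lean` (the one-body BdG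
MATRIX of a bond Hamiltonian, no operator inequality) and `ReducedBCSTorus.lean` (pair modes, CAR).
-/

noncomputable section

namespace Literature.MathematicalPhysics.QuantumLattice

open Matrix Literature.Probability.LatticeModels
open scoped ComplexOrder

section CARPair

variable {m : Type*} [Fintype m] [DecidableEq m] {c₁ c₂ : Matrix m m ℂ}

/-! #### Elementary consequences of the CAR for two modes -/

/-- `n = c†c` is idempotent when `c² = 0` and `c c† + c† c = 1`. [folklore] -/
theorem carPair_num_idem (hsq : c₁ * c₁ = 0) (hcar : c₁ * c₁ᴴ + c₁ᴴ * c₁ = 1) :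
    c₁ᴴ * c₁ * (c₁ᴴ * c₁) = c₁ᴴ * c₁ := by
  have h : c₁ * c₁ᴴ = 1 - c₁ᴴ * c₁ := eq_sub_of_add_eq hcar
  calc c₁ᴴ * c₁ * (c₁ᴴ * c₁) = c₁ᴴ * (c₁ * c₁ᴴ) * c₁ := by noncomm_ring
    _ = c₁ᴴ * (1 - c₁ᴴ * c₁) * c₁ := by rw [h]
    _ = c₁ᴴ * c₁ - c₁ᴴ * c₁ᴴ * (c₁ * c₁) := by noncomm_ring
    _ = c₁ᴴ * c₁ := by rw [hsq, Matrix.mul_zero, sub_zero]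

omit [DecidableEq m] in
/-- `c† c c = 0`. [folklore] -/
theorem carPair_num_mul_self (hsq : c₁ * c₁ = 0) : c₁ᴴ * c₁ * c₁ = 0 := by
  rw [Matrix.mul_assoc, hsq, Matrix.mul_zero]

omit [DecidableEq m] in
/-- `c† c† = 0` from `c c = 0`. [folklore] -/
theorem carPair_conjTranspose_sq (hsq : c₁ * c₁ = 0) : c₁ᴴ * c₁ᴴ = 0 := by
  rw [← conjTranspose_mul, hsq, conjTranspose_zero]

omit [DecidableEq m] in
/-- `c₁† c₂ = -c₂ c₁†` from `c₂ c₁† + c₁† c₂ = 0` (the adjoint of the mixed CAR `c₁ c₂† + c₂† c₁ = 0`).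
[folklore] -/
theorem carPair_conjTranspose_mul_eq_neg (hmixed : c₁ * c₂ᴴ + c₂ᴴ * c₁ = 0) :
    c₁ᴴ * c₂ = -(c₂ * c₁ᴴ) := by
  have h := congrArg conjTranspose hmixed
  rw [conjTranspose_add, conjTranspose_mul, conjTranspose_mul, conjTranspose_conjTranspose,
    conjTranspose_zero, add_comm] at h
  exact (eq_neg_of_add_eq_zero_left h)

omit [DecidableEq m] in
/-- `c₁† c₂† = -c₂† c₁†` from `c₁ c₂ + c₂ c₁ = 0`. [folklore] -/
theorem carPair_conjTranspose_mul_conjTranspose_eq_neg (hanti : c₁ * c₂ + c₂ * c₁ = 0) :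
    c₁ᴴ * c₂ᴴ = -(c₂ᴴ * c₁ᴴ) := by
  have h := congrArg conjTranspose hanti
  rw [conjTranspose_add, conjTranspose_mul, conjTranspose_mul, conjTranspose_zero, add_comm] at h
  exact (eq_neg_of_add_eq_zero_left h)

omit [DecidableEq m] in
/-- `n₁ = c₁†c₁` commutes with `c₂` (two anticommutations). [folklore] -/
theorem carPair_num_mul_comm (hanti : c₁ * c₂ + c₂ * c₁ = 0) (hmixed : c₁ * c₂ᴴ + c₂ᴴ * c₁ = 0) :
    c₁ᴴ * c₁ * c₂ = c₂ * (c₁ᴴ * c₁) := by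
  have h1 : c₁ * c₂ = -(c₂ * c₁) := eq_neg_of_add_eq_zero_left hanti
  have h2 : c₁ᴴ * c₂ = -(c₂ * c₁ᴴ) := carPair_conjTranspose_mul_eq_neg hmixed
  calc c₁ᴴ * c₁ * c₂ = c₁ᴴ * (c₁ * c₂) := by rw [Matrix.mul_assoc]
    _ = -(c₁ᴴ * c₂) * c₁ := by rw [h1]; noncomm_ring
    _ = c₂ * (c₁ᴴ * c₁) := by rw [h2]; noncomm_ring

omit [DecidableEq m] in
/-- `n₁` commutes with `c₂†`. [folklore] -/
theorem carPair_num_mul_conjTranspose_comm (hanti : c₁ * c₂ + c₂ * c₁ = 0)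
    (hmixed : c₁ * c₂ᴴ + c₂ᴴ * c₁ = 0) :
    c₁ᴴ * c₁ * c₂ᴴ = c₂ᴴ * (c₁ᴴ * c₁) := by
  have h1 : c₁ * c₂ᴴ = -(c₂ᴴ * c₁) := eq_neg_of_add_eq_zero_left hmixed
  have h2 : c₁ᴴ * c₂ᴴ = -(c₂ᴴ * c₁ᴴ) := carPair_conjTranspose_mul_conjTranspose_eq_neg hanti
  calc c₁ᴴ * c₁ * c₂ᴴ = c₁ᴴ * (c₁ * c₂ᴴ) := by rw [Matrix.mul_assoc]
    _ = -(c₁ᴴ * c₂ᴴ) * c₁ := by rw [h1]; noncomm_ring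
    _ = c₂ᴴ * (c₁ᴴ * c₁) := by rw [h2]; noncomm_ring

omit [DecidableEq m] in
/-- `n₁ n₂ = n₂ n₁`. [folklore] -/
theorem carPair_num_mul_num_comm (hanti : c₁ * c₂ + c₂ * c₁ = 0)
    (hmixed : c₁ * c₂ᴴ + c₂ᴴ * c₁ = 0) :
    c₁ᴴ * c₁ * (c₂ᴴ * c₂) = c₂ᴴ * c₂ * (c₁ᴴ * c₁) := by
  calc c₁ᴴ * c₁ * (c₂ᴴ * c₂) = c₁ᴴ * c₁ * c₂ᴴ * c₂ := by noncomm_ring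
    _ = c₂ᴴ * (c₁ᴴ * c₁) * c₂ := by rw [carPair_num_mul_conjTranspose_comm hanti hmixed]
    _ = c₂ᴴ * (c₁ᴴ * c₁ * c₂) := by noncomm_ring
    _ = c₂ᴴ * c₂ * (c₁ᴴ * c₁) := by rw [carPair_num_mul_comm hanti hmixed]; noncomm_ring

omit [DecidableEq m] in
/-- The pair annihilator `b = c₂ c₁` satisfies `b† b = n₁ n₂`. [folklore] -/
theorem carPair_pair_conjTranspose_mul_pair (hanti : c₁ * c₂ + c₂ * c₁ = 0)
    (hmixed : c₁ * c₂ᴴ + c₂ᴴ * c₁ = 0) :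
    (c₂ * c₁)ᴴ * (c₂ * c₁) = c₁ᴴ * c₁ * (c₂ᴴ * c₂) := by
  -- `b†b = c₁† c₂† c₂ c₁ = c₁† n₂ c₁ = n₂ c₁† c₁` ; and swap roles 1 ↔ 2 in the commutation lemma
  have hanti' : c₂ * c₁ + c₁ * c₂ = 0 := by rwa [add_comm]
  have hmixed' : c₂ * c₁ᴴ + c₁ᴴ * c₂ = 0 := by
    have h := carPair_conjTranspose_mul_eq_neg hmixed
    rw [h, add_neg_cancel]
  have hc : c₂ᴴ * c₂ * c₁ᴴ = c₁ᴴ * (c₂ᴴ * c₂) := carPair_num_mul_conjTranspose_comm hanti' hmixed'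
  calc (c₂ * c₁)ᴴ * (c₂ * c₁) = c₁ᴴ * (c₂ᴴ * c₂ * c₁) := by
        rw [conjTranspose_mul]; noncomm_ring
    _ = c₁ᴴ * (c₂ᴴ * c₂) * c₁ := by noncomm_ring
    _ = c₂ᴴ * c₂ * c₁ᴴ * c₁ := by rw [← hc]
    _ = c₁ᴴ * c₁ * (c₂ᴴ * c₂) := by
        rw [Matrix.mul_assoc, ← carPair_num_mul_num_comm hanti hmixed]

/-- The block-vacuum projection fixes the pair annihilator: `(1 - n₁)(1 - n₂) b = b`, `b = c₂ c₁`.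
[folklore] -/
theorem carPair_vacProj_mul_pair (hsq₁ : c₁ * c₁ = 0) (hsq₂ : c₂ * c₂ = 0) (hanti : c₁ * c₂ + c₂ * c₁ = 0)
    (hmixed : c₁ * c₂ᴴ + c₂ᴴ * c₁ = 0) :
    (1 - c₁ᴴ * c₁) * (1 - c₂ᴴ * c₂) * (c₂ * c₁) = c₂ * c₁ := by
  have h2 : c₂ᴴ * c₂ * c₂ = 0 := carPair_num_mul_self hsq₂
  have h1 : c₁ᴴ * c₁ * c₂ = c₂ * (c₁ᴴ * c₁) := carPair_num_mul_comm hanti hmixed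
  have h1' : c₁ᴴ * c₁ * c₁ = 0 := carPair_num_mul_self hsq₁
  calc (1 - c₁ᴴ * c₁) * (1 - c₂ᴴ * c₂) * (c₂ * c₁)
      = (1 - c₁ᴴ * c₁) * (c₂ * c₁) - (1 - c₁ᴴ * c₁) * (c₂ᴴ * c₂ * c₂) * c₁ := by noncomm_ring
    _ = (1 - c₁ᴴ * c₁) * (c₂ * c₁) := by rw [h2]; noncomm_ring
    _ = c₂ * c₁ - (c₁ᴴ * c₁ * c₂) * c₁ := by noncomm_ring
    _ = c₂ * c₁ - c₂ * (c₁ᴴ * c₁ * c₁) := by rw [h1]; noncomm_ring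
    _ = c₂ * c₁ := by rw [h1', Matrix.mul_zero, sub_zero]

/-! #### The BdG pair block as an explicit sum of squares -/

/-- **Sum-of-squares identity for the BdG pair block.** For a CAR pair `c₁, c₂` (modes `k↑`,
`-k↓`), `n_i = c_i†c_i`, `b = c₂c₁`, and real `ξ, a, λ, α, β, γ` with `α² = -λ`, `β² = 2ξ - λ`,
`αβ = -a`, `γ² = ξ - λ` (solvable iff `λ = ξ - √(ξ² + a²)`):
`ξ(n₁ + n₂) - a(b + b†) - λ = Y†Y + (γQ₁)†(γQ₁) + (γQ₂)†(γQ₂)` with `Y = α(1-n₁)(1-n₂) + βb`,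
`Q₁ = n₁(1-n₂)`, `Q₂ = n₂(1-n₁)` — the operator form of the `2 × 2` BdG eigenvalue problem
`[[0,-a],[-a,2ξ]]` on the pair states and of the singly-occupied levels at energy `ξ`.
de Gennes, *Superconductivity of Metals and Alloys* (1966), Ch. 5; von Delft–Ralph 2001, §4.2.
[folklore] -/
theorem bdg_pairBlock_eq_sum_sq (hsq₁ : c₁ * c₁ = 0) (hsq₂ : c₂ * c₂ = 0)
    (hanti : c₁ * c₂ + c₂ * c₁ = 0) (hcar₁ : c₁ * c₁ᴴ + c₁ᴴ * c₁ = 1)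
    (hcar₂ : c₂ * c₂ᴴ + c₂ᴴ * c₂ = 1) (hmixed : c₁ * c₂ᴴ + c₂ᴴ * c₁ = 0)
    {ξ a lam α β γ : ℝ} (hα : α * α = -lam) (hβ : β * β = 2 * ξ - lam) (hαβ : α * β = -a)
    (hγ : γ * γ = ξ - lam) :
    (ξ : ℂ) • (c₁ᴴ * c₁ + c₂ᴴ * c₂) - (a : ℂ) • (c₂ * c₁ + (c₂ * c₁)ᴴ) -
        (lam : ℂ) • (1 : Matrix m m ℂ) =
      ((α : ℂ) • ((1 - c₁ᴴ * c₁) * (1 - c₂ᴴ * c₂)) + (β : ℂ) • (c₂ * c₁))ᴴ *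
          ((α : ℂ) • ((1 - c₁ᴴ * c₁) * (1 - c₂ᴴ * c₂)) + (β : ℂ) • (c₂ * c₁)) +
        ((γ : ℂ) • (c₁ᴴ * c₁ * (1 - c₂ᴴ * c₂)))ᴴ * ((γ : ℂ) • (c₁ᴴ * c₁ * (1 - c₂ᴴ * c₂))) +
        ((γ : ℂ) • (c₂ᴴ * c₂ * (1 - c₁ᴴ * c₁)))ᴴ * ((γ : ℂ) • (c₂ᴴ * c₂ * (1 - c₁ᴴ * c₁))) := by
  set n₁ : Matrix m m ℂ := c₁ᴴ * c₁ with hn₁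
  set n₂ : Matrix m m ℂ := c₂ᴴ * c₂ with hn₂
  set b : Matrix m m ℂ := c₂ * c₁ with hb
  -- algebraic facts
  have hn1 : n₁ * n₁ = n₁ := carPair_num_idem hsq₁ hcar₁
  have hn2 : n₂ * n₂ = n₂ := carPair_num_idem hsq₂ hcar₂
  have hcomm : n₂ * n₁ = n₁ * n₂ := (carPair_num_mul_num_comm hanti hmixed).symm
  have hn1h : n₁ᴴ = n₁ := by rw [hn₁, conjTranspose_mul, conjTranspose_conjTranspose]
  have hn2h : n₂ᴴ = n₂ := by rw [hn₂, conjTranspose_mul, conjTranspose_conjTranspose]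
  have hPb : (1 - n₁) * (1 - n₂) * b = b := carPair_vacProj_mul_pair hsq₁ hsq₂ hanti hmixed
  have hPherm : ((1 - n₁) * (1 - n₂))ᴴ = (1 - n₁) * (1 - n₂) := by
    rw [conjTranspose_mul, conjTranspose_sub, conjTranspose_sub, conjTranspose_one, hn1h, hn2h]
    have h1 : (1 - n₂) * (1 - n₁) = 1 - n₁ - n₂ + n₂ * n₁ := by noncomm_ring
    have h2 : (1 - n₁) * (1 - n₂) = 1 - n₁ - n₂ + n₁ * n₂ := by noncomm_ring
    rw [h1, h2, hcomm]
  have hbP : bᴴ * ((1 - n₁) * (1 - n₂)) = bᴴ := by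
    have h := congrArg conjTranspose hPb
    rwa [conjTranspose_mul, hPherm] at h
  have he1 : (1 - n₁) * (1 - n₁) = 1 - n₁ := by
    have : (1 - n₁) * (1 - n₁) = 1 - n₁ - n₁ + n₁ * n₁ := by noncomm_ring
    rw [this, hn1]; abel
  have he2 : (1 - n₂) * (1 - n₂) = 1 - n₂ := by
    have : (1 - n₂) * (1 - n₂) = 1 - n₂ - n₂ + n₂ * n₂ := by noncomm_ring
    rw [this, hn2]; abel
  have hcomm' : (1 - n₂) * (1 - n₁) = (1 - n₁) * (1 - n₂) := by
    have h1 : (1 - n₂) * (1 - n₁) = 1 - n₁ - n₂ + n₂ * n₁ := by noncomm_ring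
    have h2 : (1 - n₁) * (1 - n₂) = 1 - n₁ - n₂ + n₁ * n₂ := by noncomm_ring
    rw [h1, h2, hcomm]
  have hPP : (1 - n₁) * (1 - n₂) * ((1 - n₁) * (1 - n₂)) = (1 - n₁) * (1 - n₂) := by
    calc (1 - n₁) * (1 - n₂) * ((1 - n₁) * (1 - n₂))
        = (1 - n₁) * ((1 - n₂) * (1 - n₁)) * (1 - n₂) := by noncomm_ring
      _ = (1 - n₁) * ((1 - n₁) * (1 - n₂)) * (1 - n₂) := by rw [hcomm']
      _ = (1 - n₁) * (1 - n₁) * ((1 - n₂) * (1 - n₂)) := by noncomm_ring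
      _ = (1 - n₁) * (1 - n₂) := by rw [he1, he2]
  have h4 : n₁ * n₂ * n₂ = n₁ * n₂ := by rw [Matrix.mul_assoc, hn2]
  have h5 : n₁ * n₂ * n₁ = n₁ * n₂ := by rw [Matrix.mul_assoc, hcomm, ← Matrix.mul_assoc, hn1]
  have hbb : bᴴ * b = n₁ * n₂ := carPair_pair_conjTranspose_mul_pair hanti hmixed
  have hQ1 : (n₁ * (1 - n₂))ᴴ * (n₁ * (1 - n₂)) = n₁ - n₁ * n₂ := by
    rw [conjTranspose_mul, conjTranspose_sub, conjTranspose_one, hn1h, hn2h]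
    have : (1 - n₂) * n₁ * (n₁ * (1 - n₂)) =
        n₁ * n₁ - n₁ * n₁ * n₂ - n₂ * n₁ * n₁ + n₂ * n₁ * n₁ * n₂ := by noncomm_ring
    rw [this, Matrix.mul_assoc n₂ n₁ n₁, hn1, hcomm, h4]
    noncomm_ring
  have hQ2 : (n₂ * (1 - n₁))ᴴ * (n₂ * (1 - n₁)) = n₂ - n₁ * n₂ := by
    rw [conjTranspose_mul, conjTranspose_sub, conjTranspose_one, hn1h, hn2h]
    have : (1 - n₁) * n₂ * (n₂ * (1 - n₁)) =
        n₂ * n₂ - n₂ * n₂ * n₁ - n₁ * n₂ * n₂ + n₁ * n₂ * n₂ * n₁ := by noncomm_ring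
    rw [this, Matrix.mul_assoc n₁ n₂ n₂, hn2, hcomm, h5]
    noncomm_ring
  have hstar : ∀ r : ℝ, star (r : ℂ) = (r : ℂ) := fun r => by
    rw [Complex.star_def, Complex.conj_ofReal]
  -- expand the squares
  have hY : ((α : ℂ) • ((1 - n₁) * (1 - n₂)) + (β : ℂ) • b)ᴴ *
      ((α : ℂ) • ((1 - n₁) * (1 - n₂)) + (β : ℂ) • b) =
      ((-lam : ℝ) : ℂ) • ((1 - n₁) * (1 - n₂)) + ((-a : ℝ) : ℂ) • b + ((-a : ℝ) : ℂ) • bᴴ +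
        ((2 * ξ - lam : ℝ) : ℂ) • (n₁ * n₂) := by
    rw [conjTranspose_add, conjTranspose_smul, conjTranspose_smul, hPherm, hstar, hstar,
      Matrix.add_mul, Matrix.mul_add, Matrix.mul_add, smul_mul_smul_comm, smul_mul_smul_comm,
      smul_mul_smul_comm, smul_mul_smul_comm, hPP, hPb, hbP, hbb, ← Complex.ofReal_mul,
      ← Complex.ofReal_mul, ← Complex.ofReal_mul, ← Complex.ofReal_mul, hα, hαβ, mul_comm β α, hαβ,
      hβ]
    abel
  have hZ1 : ((γ : ℂ) • (n₁ * (1 - n₂)))ᴴ * ((γ : ℂ) • (n₁ * (1 - n₂))) =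
      ((ξ - lam : ℝ) : ℂ) • (n₁ - n₁ * n₂) := by
    rw [conjTranspose_smul, hstar, smul_mul_smul_comm, hQ1, ← Complex.ofReal_mul, hγ]
  have hZ2 : ((γ : ℂ) • (n₂ * (1 - n₁)))ᴴ * ((γ : ℂ) • (n₂ * (1 - n₁))) =
      ((ξ - lam : ℝ) : ℂ) • (n₂ - n₁ * n₂) := by
    rw [conjTranspose_smul, hstar, smul_mul_smul_comm, hQ2, ← Complex.ofReal_mul, hγ]
  rw [hY, hZ1, hZ2]
  have hP : (1 - n₁) * (1 - n₂) = 1 - n₁ - n₂ + n₁ * n₂ := by noncomm_ring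
  rw [hP, hb, conjTranspose_mul]
  push_cast
  module

/-- **The BdG pair block is bounded below by its lowest quasi-particle level**: for a CAR pair
`c₁, c₂` and real `ξ` (level energy) and `a` (pair amplitude),
`ξ(n₁ + n₂) - a(b + b†) - (ξ - √(ξ² + a²))·1 ≥ 0`, `b = c₂c₁`. The spectrum of the block is
`{ξ ± √(ξ² + a²)}` on the pair states `|0⟩, b†|0⟩` and `{ξ, ξ}` on the singly occupied ones;
this is the operator inequality behind BCS/Bogoliubov lower bounds.
de Gennes 1966, Ch. 5; Bach–Lieb–Solovej, J. Stat. Phys. 76 (1994) 3, §2 (quasi-free lower bounds).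
[folklore] -/
theorem bdg_pairBlock_posSemidef (hsq₁ : c₁ * c₁ = 0) (hsq₂ : c₂ * c₂ = 0)
    (hanti : c₁ * c₂ + c₂ * c₁ = 0) (hcar₁ : c₁ * c₁ᴴ + c₁ᴴ * c₁ = 1)
    (hcar₂ : c₂ * c₂ᴴ + c₂ᴴ * c₂ = 1) (hmixed : c₁ * c₂ᴴ + c₂ᴴ * c₁ = 0) (ξ a : ℝ) :
    ((ξ : ℂ) • (c₁ᴴ * c₁ + c₂ᴴ * c₂) - (a : ℂ) • (c₂ * c₁ + (c₂ * c₁)ᴴ) -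
        ((ξ - Real.sqrt (ξ ^ 2 + a ^ 2) : ℝ) : ℂ) • (1 : Matrix m m ℂ)).PosSemidef := by
  set lam : ℝ := ξ - Real.sqrt (ξ ^ 2 + a ^ 2) with hlam
  have hroot : Real.sqrt (ξ ^ 2 + a ^ 2) * Real.sqrt (ξ ^ 2 + a ^ 2) = ξ ^ 2 + a ^ 2 :=
    Real.mul_self_sqrt (by positivity)
  have habs : |ξ| ≤ Real.sqrt (ξ ^ 2 + a ^ 2) := by
    rw [← Real.sqrt_sq_eq_abs]
    exact Real.sqrt_le_sqrt (by nlinarith [sq_nonneg a])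
  have hneg : 0 ≤ -lam := by
    have := le_abs_self ξ
    simp only [hlam]; linarith
  have h2 : 0 ≤ 2 * ξ - lam := by
    have := neg_abs_le ξ
    simp only [hlam]; linarith
  have hγ0 : 0 ≤ ξ - lam := by simp only [hlam]; linarith [Real.sqrt_nonneg (ξ ^ 2 + a ^ 2)]
  set α : ℝ := Real.sqrt (-lam)
  set s : ℝ := if 0 ≤ a then -1 else 1 with hs
  set β : ℝ := s * Real.sqrt (2 * ξ - lam)
  set γ : ℝ := Real.sqrt (ξ - lam)
  have hα : α * α = -lam := Real.mul_self_sqrt hneg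
  have hss : s * s = 1 := by simp only [hs]; split_ifs <;> norm_num
  have hβ : β * β = 2 * ξ - lam := by
    calc β * β = s * s * (Real.sqrt (2 * ξ - lam) * Real.sqrt (2 * ξ - lam)) := by ring
      _ = 2 * ξ - lam := by rw [hss, Real.mul_self_sqrt h2, one_mul]
  have hprod : -lam * (2 * ξ - lam) = a ^ 2 := by
    have : lam * lam - 2 * ξ * lam - a ^ 2 = 0 := by
      simp only [hlam]; nlinarith [hroot]
    nlinarith [this]
  have hαβ : α * β = -a := by
    have hsa : s * |a| = -a := by
      simp only [hs]; split_ifs with h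
      · rw [abs_of_nonneg h]; ring
      · rw [abs_of_neg (lt_of_not_ge h)]; ring
    calc α * β = s * (Real.sqrt (-lam) * Real.sqrt (2 * ξ - lam)) := by ring
      _ = s * Real.sqrt (-lam * (2 * ξ - lam)) := by rw [← Real.sqrt_mul hneg]
      _ = s * |a| := by rw [hprod, Real.sqrt_sq_eq_abs]
      _ = -a := hsa
  have hγ : γ * γ = ξ - lam := Real.mul_self_sqrt hγ0
  rw [bdg_pairBlock_eq_sum_sq hsq₁ hsq₂ hanti hcar₁ hcar₂ hmixed hα hβ hαβ hγ]
  exact ((posSemidef_conjTranspose_mul_self _).add (posSemidef_conjTranspose_mul_self _)).add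
    (posSemidef_conjTranspose_mul_self _)

end CARPair

/-! #### The pair modes of the fermionic torus -/

section Torus

variable {d L : ℕ} [NeZero L]

/-- `c_{kσ}² = 0` for the Bloch modes (Pauli). [folklore] -/
theorem momentumAnnihilation_mul_self (k : TorusSite d L) (σ : Fin 2) :
    momentumAnnihilation k σ * momentumAnnihilation k σ = 0 := by
  have h := momentumAnnihilation_anticomm k k σ σ
  rw [← two_smul ℂ] at h
  exact (smul_eq_zero.1 h).resolve_left two_ne_zero

/-- **The BdG block of a time-reversed pair of Bloch modes is bounded below by its lowest
quasi-particle level**: for every momentum `k`, level energy `ξ` and pair amplitude `a`,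
`ξ(n_{k↑} + n_{-k↓}) - a(b_k + b_k†) - (ξ - √(ξ² + a²))·1 ≥ 0` on the full Fock space of the
fermionic torus (`b_k = c_{-k↓}c_{k↑} = pairMode k`). [folklore] -/
theorem pairMode_block_posSemidef (k : TorusSite d L) (ξ a : ℝ) :
    ((ξ : ℂ) • (momentumNumber k 0 + momentumNumber (-k) 1) - (a : ℂ) • (pairMode k + (pairMode k)ᴴ) -
      ((ξ - Real.sqrt (ξ ^ 2 + a ^ 2) : ℝ) : ℂ) •
        (1 : Matrix (Finset (Orb (FermionTorus d L))) (Finset (Orb (FermionTorus d L))) ℂ)).PosSemidef := by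
  have hsq₁ := momentumAnnihilation_mul_self k (0 : Fin 2)
  have hsq₂ := momentumAnnihilation_mul_self (-k) (1 : Fin 2)
  have hanti := momentumAnnihilation_anticomm k (-k) (0 : Fin 2) 1
  have hcar₁ : momentumAnnihilation k 0 * (momentumAnnihilation k 0)ᴴ +
      (momentumAnnihilation k 0)ᴴ * momentumAnnihilation k (0 : Fin 2) = 1 := by
    rw [momentumAnnihilation_conjTranspose, momentumAnnihilation_mul_momentumCreation_add]
    simp
  have hcar₂ : momentumAnnihilation (-k) 1 * (momentumAnnihilation (-k) 1)ᴴ +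
      (momentumAnnihilation (-k) 1)ᴴ * momentumAnnihilation (-k) (1 : Fin 2) = 1 := by
    rw [momentumAnnihilation_conjTranspose, momentumAnnihilation_mul_momentumCreation_add]
    simp
  have hmixed : momentumAnnihilation k 0 * (momentumAnnihilation (-k) 1)ᴴ +
      (momentumAnnihilation (-k) 1)ᴴ * momentumAnnihilation k (0 : Fin 2) = 0 := by
    rw [momentumAnnihilation_conjTranspose, momentumAnnihilation_mul_momentumCreation_add]
    simp
  exact bdg_pairBlock_posSemidef hsq₁ hsq₂ hanti hcar₁ hcar₂ hmixed ξ a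

end Torus

end Literature.MathematicalPhysics.QuantumLattice

end
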